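import Summits.BirchSwinnertonDyer.BirchSwinnertonDyer.Theses.PrintX10b
import Literature.NumberTheory.EllipticCurves.IwasawaAlgebraPromotionProofs
import HarnessLib

/-!
# Line «gorenstein-layer-mu-x10b» — the μ-inequality of `PrintX10b.MuPartSharpX10b` from
# LAYER-WISE Kolyvagin bounds with GORENSTEIN coefficients `Λ/(ν_{k₀,j}, p^M)` (crux skeleton, bsd-idea-5 g5, REV 2 g6 = the ladder G1a/G1b/G2(j)/G2-uniform,
# lens «transfer»; PUBLISH-ONLY per W-79 — the line of record on this crux dir stays `torsion_depth_x10b`)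

Target concluded BY NAME: `Summit.BirchSwinnertonDyer.BirchSwinnertonDyer.Theses.PrintX10b.MuPartSharpX10b`
(stmt-BirchSwinnertonDyer-27487, the one OPEN child of the split deciding crux 27275) — and, through the
route's own glue decl `HowardContainmentLightFrameX10bPinnedOfPrintOfSplit` (27488) and the two print
siblings `CoprimeTiedX10b` (27485) / `EnvelopeModulesSharpX10b` (27486) taken BY NAME as hypotheses,
the parent `HowardContainmentLightFrameX10bPinnedOfPrint` (27275).

THE LEVER (none of the nine x10b lines uses it). Every existing line bounds `μ(X_tors)` through a
`Λ`-ADIC Kolyvagin system (Howard / Mastella–Zerman port at torsion depth `δ`, specialisation at Howard's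
DVR primes `q_m = T^m + p`, `Ω = Λ/3`-adic systems, Greenberg-side transport, congruent partners). This
line never builds a `Λ`-adic system and never specialises at a twisted prime: it works at the FINITE
LAYERS `K_k` (`k = k₀ + j`) of the anticyclotomic tower with the CLASSICAL Heegner points
`y_k ∈ E(K_k)` and Kolyvagin's derivative classes over `K_k[n]`, but with coefficients in the
zero-dimensional GORENSTEIN (complete-intersection) rings `R_{k,M} = ℤ/p^M [Gal(K_k/K_{k₀})] = Λ/(ν_{k₀,j}, p^M)`
instead of a DVR. At a fixed layer there is no tower, hence no torsion depth, no envelope, no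
`K_∞ ∩ K[1]`: the class number enters only through `K_k ⊂ K[p^{k+1+δ}]`, and Kolyvagin primes `ℓ`
(inert in `K`) split completely in every ring class field, so the local theory at `ℓ` is Howard's
`⊗ R_{k,M}`. The whole beyond-print content becomes ONE statement (`stub_layerKolyvagin_gorenstein`):
a Howard-type (τ = complex conjugation, residually 2-group image handled by the Mastella–Zerman scalar
Čebotarev device at finite level `M`) Kolyvagin-system bound over the Gorenstein rings `R_{k,M}`, with
error `p^{O(k)}` — NOT `p^{O(p^k)}` — uniformly in `M`; Matlis duality over `R_{k,M}` (self-injective)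
replaces the DVR length count, exactly the move of Sakamoto / Burns–Sakamoto–Sano / Bullach–Burns for
Mazur–Rubin-type systems (transfer source; the anticyclotomic sign-alternating variant is the research stub).
The output is the LAYER GROWTH INEQUALITY `#(X_tors/ν X_tors) ≤ p^{C(j+1)} · #(𝔖/(ℋ_F + ν𝔖))²`, and
Iwasawa's growth formula along `ν_{k₀,j}` (`stub_lengthAt_le_two_mul_of_layerCard_le`, pure `Λ`-module
algebra, the `ν`-analogue of x10b-p1's LANDED `q_m`-lemma
`IwasawaAlgebra.lengthAt_le_two_mul_of_card_quotSMulTop_qm_le`) turns it into the μ-inequality, which the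
lead's 15-line promotion (`muPartSharp_of_muInequality`, rev 27) turns into `MuPartSharpX10b`.

WHY LAYERS AND NOT `q_m` (the transfer dictionary). Howard/MZ: DVR coefficients `Λ/q_m ≅ ℤ_p[p^{1/m}]`
× `Λ`-adic interpolation (needs the `Λ`-adic KS at `3 ∣ h_K` = CGLS22 Thm 4.1.1 by signature, control at
twisted specialisations = MR04 Prop 5.3.14, risk R1 of F1ReadCheckSpecialiseFirstMu.md). This line:
Gorenstein coefficients `ℤ_p[Γ_k/Γ_{k₀}]` × honest arithmetic over the number fields `K_k` (classical
Kolyvagin, Gross–Zagier/Cornut–Vatsal non-vanishing at some layer, anticyclotomic control of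
Greenberg/JSW type which uses total ramification only as finiteness). μ-tightness moves from «control error
independent of `m`» to «Kolyvagin error linear in `k`»; character-by-character bounds (MZ Thm 2.40 per `χ`,
Bertolini–Darmon 1990, Nekovář 2007) are NOT enough: `[∏_χ 𝒪_χ : ℤ_p[C_{p^k}]]` is `p^{≍ p^k}`, a μ-sized
loss — hence the equivariant (Gorenstein) coefficients are forced, and are the new object.

REV 2 (g6, critic V#41 price P1 = «LADDER G»): the research statement (G) is no longer a stub — it is
DERIVED (sorry-free, `layerKolyvaginGorenstein_of_ladder`) from three typed rungs over the FINITE LAYERS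
`K_k`, `k = k₀ + j`, all stated over existing tree objects (`selmerGroupOver`, `compactSelmerOver`,
`heegnerModuleLayer`, `conjH1` / `conjPi`): (G1a) `Stmt.controlSelmerNu` — anticyclotomic CONTROL on the
Selmer side, `#(X_tors/ν_{k₀,j}) ≤ p^{C(k+1)} · Q(k₀,j)` with `Q(k₀,j) = #(Sel_{p^∞}(E/K_k)[ν_{k₀,j}] / div)`;
(G1b) `Stmt.controlHeegnerNu` — CONTROL on the Heegner side, `I(k₀,j) ≤ p^{C(k+1)} · #((𝔖/ℋ_F)/ν_{k₀,j})` with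
`I(k₀,j) = [S_p(E/K_k) : ℋ̄_k + ν_{k₀,j} S_p(E/K_k)]` (compact control + Cornut–Vatsal non-vanishing +
Bertolini–Darmon rank one per character, all print, plus bookkeeping); (G2) the FIXED-LAYER equivariant
Kolyvagin inequality `Q(k₀,j) ≤ p^{C_j} · I(k₀,j)²`, typed PER `j` as `Stmt.layerKolyvaginAt j` — in the
`ν`-currency of (G) the coefficient ring at `(k₀, j)` is `Λ/(ν_{k₀,j}, p^M)`: `j = 0` is vacuous, `j = 1`
(`Λ/ν_{k₀,1} = ℤ_p[ζ_{p^{k₀+1}}]`, a DVR) is the PRINT-ADJACENT RUNG `stub_layerKolyvaginAt_one` = Kolyvagin's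
descent at ONE character level (Bertolini–Darmon 1990 + Howard's DVR machine §2 / MZ26 Thm 2.40 at the
height-one prime `Φ_{p^{k₀+1}}(1+T)`), `j = 2` (`Λ/(Φ_{p^{k₀+1}}Φ_{p^{k₀+2}})`, the first non-DVR Gorenstein
ring) is the first research instance, and «uniform in `j` with exponent linear in `j`»,
`Stmt.layerKolyvaginUniform`, is the honest RESIDUAL that (G) needs. Sorries = the five stubs A, G1a, G1b,
G2(1) (rung, not in the cone), G2-uniform; (G), the μ-inequality, `MuPartSharpX10b` and the parent are
kernel-checked compositions.

HONEST FRAMING: a SKELETON. `sorry` ONLY inside the five `stub_*`; the compositions `layerKolyvaginGorenstein_of_ladder`,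
`muInequality_of_layers`, `MuPartSharpX10b_of`, `parent_of`, `parent_of_ladder` are kernel-checked. Nothing here is registered (`ledger skeleton check`
NOT run, W-79). No summit statement is proved; BSD is not proved by any of this.

References: [Howard2004HeegnerKolyvagin] Thm 2.2.10 and its proof (arXiv:1202.6340 p.17–18);
[MastellaZerman2026] arXiv:2505.08710 Lemma 2.39, Thm 2.40, Thm 3.15; [CastellaGrossiLeeSkinner2022] Thm 4.1.1;
Sakamoto, *Stark systems over Gorenstein local rings*, ANT 12 (2018) doi:10.2140/ant.2018.12.2295;
Burns–Sakamoto–Sano, *higher rank Euler, Kolyvagin and Stark systems II* arXiv:1805.08448 (Gorenstein orders);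
Bullach–Burns, *On Euler systems and Nekovář–Selmer complexes* arXiv:2509.13894 (2025) §3.2–3.3 (pairs of
zero-dimensional Gorenstein rings `R_i`, Thm 68; no Heegner/anticyclotomic case); Bertolini–Darmon,
*Kolyvagin's descent and Mordell–Weil groups over ring class fields*, Crelle 412 (1990); [Washington1997] §13.3
(Thm 13.13, Lemmas 13.15–13.21: growth along `ν_{n,m}`); [Greenberg1999] / Jetchev–Skinner–Wan anticyclotomic control.
-/

set_option linter.dupNamespace false
set_option autoImplicit false

noncomputable section

open scoped Classical Pointwise
open Literature Literature.NumberTheory.EllipticCurves WeierstrassCurve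
open Literature.NumberTheory.EllipticCurves.Rank1Residual (ClassX10 Surj)
open Literature.NumberTheory.EllipticCurves.ModularForms (ModularParametrizationData)

namespace Summit.BirchSwinnertonDyer.BirchSwinnertonDyer.Cruxes.HowardContainmentAnyClassNumberX10b.GorensteinLayerMuX10b

open Summit.BirchSwinnertonDyer.BirchSwinnertonDyer.Theses.PrintX10b

/-! ## §0 The layer elements `ν_{k₀,j} = Σ_{i<p^j} ((1+T)^{p^{k₀}})^i ∈ Λ` (`ω_{k₀+j} = ω_{k₀} · ν_{k₀,j}`) -/

/-- `ν_{k₀,j}`: the norm element from layer `k₀` to layer `k₀ + j` (Washington §13.3: `ν_{n,m}`);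
`Λ/(ν_{k₀,j}) = ℤ_p[Gal(K_{k₀+j}/K)] / (ω_{k₀})`-part — a reduced one-dimensional Gorenstein ring. -/
def layerNu (p : ℕ) [Fact p.Prime] (k₀ j : ℕ) : IwasawaAlgebra p :=
  ∑ i ∈ Finset.range (p ^ j), ((1 + PowerSeries.X : IwasawaAlgebra p) ^ (p ^ k₀)) ^ i

/-- `#(N ⧸ ν_{k₀,j} N)` (junk value `0` when infinite — every use below carries a `Finite` conjunct). -/
def layerCard (p : ℕ) [Fact p.Prime] (N : Type) [AddCommGroup N] [Module (IwasawaAlgebra p) N]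
    (k₀ j : ℕ) : ℕ :=
  Nat.card (N ⧸ (Ideal.span {layerNu p k₀ j} • ⊤ : Submodule (IwasawaAlgebra p) N))

/-- `ν_{k₀,j}` as an OPERATOR on `∏_m H¹(K_k, E[p^m])` (`k` any layer; used at `k = k₀ + j`):
`d ↦ Σ_{i<p^j} conj_{γ^{p^{k₀} i}} d` — the action of `layerNu p k₀ j` through `T ↦ conj_γ - 1`
(`LambdaAdicSelmerData.proj_X`). [cite: PerrinRiou1987BSMF, §0 pp. 400–402] -/
def layerNuPi (p : ℕ) [Fact p.Prime] {L : Type} [Field L] [NumberField L] (V : WeierstrassCurve L)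
    (κ : ZpExtension L p) (γ : Field.absoluteGaloisGroup L) (k₀ j k : ℕ) :
    (Π m : ℕ, V.torsionH1Over ((p : ℤ) ^ m) (κ.layerSubgroup k)) →+
      Π m : ℕ, V.torsionH1Over ((p : ℤ) ^ m) (κ.layerSubgroup k) :=
  ∑ i ∈ Finset.range (p ^ j), V.conjPi p (κ.layerSubgroup k) (γ ^ (p ^ k₀ * i))

/-- `ν_{k₀,j}` as an operator on `H¹(K_k, E[p^∞])`. [cite: GreenbergLNM1716, §1–2] -/
def layerNuH1 (p : ℕ) [Fact p.Prime] {L : Type} [Field L] [NumberField L] (V : WeierstrassCurve L)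
    (κ : ZpExtension L p) (γ : Field.absoluteGaloisGroup L) (k₀ j k : ℕ) :
    V.subgroupH1 p (κ.layerSubgroup k) →+ V.subgroupH1 p (κ.layerSubgroup k) :=
  ∑ i ∈ Finset.range (p ^ j), V.conjH1 p (κ.layerSubgroup k) (γ ^ (p ^ k₀ * i))

/-- `#(A / A_div)`-proxy for a cofinitely generated `ℤ_p`-module: `sup_M #(A / p^M A)` (junk `0` if the
cardinalities are unbounded). [folklore] -/
def nondivCard (p : ℕ) (A : Type) [AddCommGroup A] : ℕ :=
  ⨆ M : ℕ, Nat.card (A ⧸ (zsmulAddGroupHom ((p : ℤ) ^ M) : A →+ A).range)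

/-- **`Q(k₀,j)`** — the Selmer-side pivot at layer `k = k₀ + j`: `#(Sel_{p^∞}(E/K_k)[ν_{k₀,j}] / div)`,
the non-divisible quotient of the `ν_{k₀,j}`-torsion of the `p^∞`-Selmer group of `E` over the NUMBER FIELD
`K_k` (by duality `= #((𝒳_k/ν 𝒳_k)_{ℤ_p-tors})`, `𝒳_k = Sel_{p^∞}(E/K_k)^∨`; morally `#Ш(E/K_k)[p^∞]` in the
characters of level `k₀ < t ≤ k`). [cite: GreenbergLNM1716, §2] -/
def selmerLayerNuCard (p : ℕ) [Fact p.Prime] {L : Type} [Field L] [NumberField L] (V : WeierstrassCurve L)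
    (κ : ZpExtension L p) (γ : Field.absoluteGaloisGroup L) (k₀ j : ℕ) : ℕ :=
  nondivCard p ↥(V.selmerGroupOver p (κ.layerSubgroup (k₀ + j)) ⊓
    (layerNuH1 p V κ γ k₀ j (k₀ + j)).ker)

/-- **`I(k₀,j)`** — the Heegner-side pivot at layer `k = k₀ + j`: the index
`[S_p(E/K_k) : ℋ̄_k + ν_{k₀,j} S_p(E/K_k)]` of the finite-level Heegner module plus the `ν`-multiples inside
the compact Selmer group of `K_k` (junk `0` if infinite — finite for `k₀ ≫ 0` by Cornut–Vatsal non-vanishing and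
Bertolini–Darmon rank one at every character of level in `(k₀, k]`).
[cite: Howard2004HeegnerKolyvagin, §3.3 (H_k)] [cite: PerrinRiou1987BSMF, §3.4] -/
def heegnerLayerNuIndex {L : Type} [Field L] [NumberField L] {N : ℕ} [NeZero N] {V : WeierstrassCurve ℚ}
    {p : ℕ} [Fact p.Prime] {κ : ZpExtension L p} {jbar : AlgebraicClosure L →+* ℂ}
    (γ : Field.absoluteGaloisGroup L) (F : HeegnerFamily N V L κ jbar) (k₀ j : ℕ) : ℕ :=
  (heegnerModuleLayer γ F (k₀ + j) ⊔
      ((V.baseChange L).compactSelmerOver (κ.layerSubgroup (k₀ + j)) p).map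
        (layerNuPi p (V.baseChange L) κ γ k₀ j (k₀ + j))).relIndex
    ((V.baseChange L).compactSelmerOver (κ.layerSubgroup (k₀ + j)) p)

/-! ## §1 Statements -/

/-- (A) **μ from layer growth** — pure `Λ`-module algebra (Iwasawa's growth theorem along `ν_{k₀,j}` in
inequality form; the `ν`-analogue of x10b-p1's landed `lengthAt_le_two_mul_of_card_quotSMulTop_qm_le`):
for finitely generated torsion `N, N'`, a uniform family of LAYER index inequalities
`#(N/νN) ≤ p^{C(j+1)} · #(N'/νN')²` on FINITE layer quotients (all `j ≥ j₀`, some base `k₀`) forces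
`length_(p) N ≤ 2 · length_(p) N'`, i.e. `μ(N) ≤ 2 μ(N')`
(`#(E/ν_{k₀,j}E) = p^{μ(E) p^{k₀}(p^j - 1) + λ' j + O(1)}` for `E` elementary with `char E` coprime to `ν`,
finiteness ⇒ coprimality, pseudo-isomorphism invariance of the growth up to `p^{O(1)}`). Size M. -/
def Stmt.lengthAtOfLayerCard : Prop :=
  ∀ (p : ℕ) [Fact p.Prime] (N N' : Type) [AddCommGroup N] [Module (IwasawaAlgebra p) N]
    [AddCommGroup N'] [Module (IwasawaAlgebra p) N']
    [Module.Finite (IwasawaAlgebra p) N] [Module.Finite (IwasawaAlgebra p) N'],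
    Module.IsTorsion (IwasawaAlgebra p) N → Module.IsTorsion (IwasawaAlgebra p) N' →
    (∃ C k₀ j₀ : ℕ, ∀ j : ℕ, j₀ ≤ j →
      Finite (N ⧸ (Ideal.span {layerNu p k₀ j} • ⊤ : Submodule (IwasawaAlgebra p) N)) ∧
      Finite (N' ⧸ (Ideal.span {layerNu p k₀ j} • ⊤ : Submodule (IwasawaAlgebra p) N')) ∧
      layerCard p N k₀ j ≤ p ^ (C * (j + 1)) * layerCard p N' k₀ j ^ 2) →
    ∀ 𝔭 : PrimeSpectrum (IwasawaAlgebra p), 𝔭.asIdeal = Ideal.span {(p : IwasawaAlgebra p)} →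
      Module.lengthAt (IwasawaAlgebra p) N 𝔭 ≤ 2 * Module.lengthAt (IwasawaAlgebra p) N' 𝔭

/-- (G) **Layer-wise Kolyvagin bound with Gorenstein coefficients** — THE research stub (size L/XL; not in
print). In the frame of `MuPartSharpX10b` (class X10b at `p = 3`, `3 ∣ h_K`, `(irr_K)`, Heegner hypotheses,
anticyclotomic `κ`, a `Λ`-adic Selmer datum `D`, Heegner family `F` over `Dt` with `3 ∤ c`, Selmer dual `X`,
`𝔖/ℋ_F` torsion): there are `C, k₀, j₀` such that for every `j ≥ j₀` the layer quotients
`X_tors/ν_{k₀,j}` and `(𝔖/ℋ_F)/ν_{k₀,j}` are finite and `#(X_tors/ν) ≤ 3^{C(j+1)} · #((𝔖/ℋ_F)/ν)²`.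
Intended proof (the line): (G1) anticyclotomic control at layer `k = k₀+j` with error `p^{O(k)}`
(`X/ω_k ↔ Sel_{p^∞}(E/K_k)^∨`, `𝔖/ω_k ↔ ` the compact Selmer group over `K_k`; total ramification used only as
finiteness, cf. F1ReadCheckSpecialiseFirstMu.md rows H3/H4/B4/B5); (G2) the EQUIVARIANT Kolyvagin inequality over
`R_{k,M} = ℤ/p^M[Gal(K_k/K_{k₀})]`: `Fitt⁰_{R}(Ш(E/K_k)[p^M]^{±}) ⊇ (index of y_k in the rank-one part)^2 · p^{O(k)}`
from Kolyvagin's derivative classes of the classical Heegner points over `K_k[n]`, Howard's sign-alternating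
eigenspace argument and the Mastella–Zerman scalar Čebotarev lemma run over the self-injective ring `R_{k,M}`
(Matlis duality instead of DVR lengths: Sakamoto 2018 / Bullach–Burns 2025 Thm 68 for the MR-type case).
Why it might fail: freeness of the rank-one part of `Sel(K_k, E[p^M])` over `R_{k,M}` (needed to split off
`M ⊕ M`) can fail at layers where `y_k` is residually trivial («trivial zeros mod p», Bullach–Burns §1) —
the error must then be shown `p^{O(k)}`, not `p^{O(p^k)}`. -/
def Stmt.layerKolyvaginGorenstein : Prop :=
  ∀ (W : WeierstrassCurve ℚ) [W.IsElliptic] [W.IsGloballyMinimal] (p : ℕ) [Fact p.Prime]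
    [NeZero (W.conductorNorm ℤ)] (K : Type) [Field K] [NumberField K],
    ClassX10 W p → ¬ Surj W 3 → ¬ W.HasCM →
    IsImaginaryQuadratic K → Odd (NumberField.discr K) → NumberField.discr K ≠ -3 →
    SatisfiesHeegnerHypothesis (W.conductorNorm ℤ) K → SatisfiesHeegnerHypothesis p K →
    (W.baseChange K).HasIrreducibleModPGaloisRep p →
    ∀ (κ : ZpExtension K p), κ.IsAnticyclotomic → ∀ (γ : Field.absoluteGaloisGroup K),
    κ.IsTopGenerator γ → ∀ (Dt : ModularParametrizationData W (W.conductorNorm ℤ)) (jbar : AlgebraicClosure K →+* ℂ),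
    ¬ (p : ℤ) ∣ Dt.c → p ∣ NumberField.classNumber K →
    ∀ (D : (W.baseChange K).LambdaAdicSelmerData κ γ) (F : HeegnerFamily (W.conductorNorm ℤ) W K κ jbar)
      (X : (W.baseChange K).SelmerDualData κ γ), F.Dt = Dt →
    Module.Finite (IwasawaAlgebra p) D.S → Module.Finite (IwasawaAlgebra p) X.X →
    Module.IsTorsion (IwasawaAlgebra p) (D.S ⧸ heegnerModule D F) →
    ∃ C k₀ j₀ : ℕ, ∀ j : ℕ, j₀ ≤ j →
      Finite (Submodule.torsion (IwasawaAlgebra p) X.X ⧸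
        (Ideal.span {layerNu p k₀ j} • ⊤ : Submodule (IwasawaAlgebra p) (Submodule.torsion (IwasawaAlgebra p) X.X))) ∧
      Finite ((D.S ⧸ heegnerModule D F) ⧸
        (Ideal.span {layerNu p k₀ j} • ⊤ : Submodule (IwasawaAlgebra p) (D.S ⧸ heegnerModule D F))) ∧
      layerCard p (Submodule.torsion (IwasawaAlgebra p) X.X) k₀ j ≤
        p ^ (C * (j + 1)) * layerCard p (D.S ⧸ heegnerModule D F) k₀ j ^ 2

/-- The μ-INEQUALITY at `𝔭 = (p)` — verbatim the hypothesis `hμ` of the lead's `muPartSharp_of_muInequality`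
(torsion_depth_x10b_pinned_rev27.lean), i.e. the currency `MuPartSharpX10b` is «in disguise». -/
def Stmt.muInequality : Prop :=
  ∀ (W : WeierstrassCurve ℚ) [W.IsElliptic] [W.IsGloballyMinimal] (p : ℕ) [Fact p.Prime]
    [NeZero (W.conductorNorm ℤ)] (K : Type) [Field K] [NumberField K],
    ClassX10 W p → ¬ Surj W 3 → ¬ W.HasCM →
    IsImaginaryQuadratic K → Odd (NumberField.discr K) → NumberField.discr K ≠ -3 →
    SatisfiesHeegnerHypothesis (W.conductorNorm ℤ) K → SatisfiesHeegnerHypothesis p K →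
    (W.baseChange K).HasIrreducibleModPGaloisRep p →
    ∀ (κ : ZpExtension K p), κ.IsAnticyclotomic → ∀ (γ : Field.absoluteGaloisGroup K),
    κ.IsTopGenerator γ → ∀ (Dt : ModularParametrizationData W (W.conductorNorm ℤ)) (jbar : AlgebraicClosure K →+* ℂ),
    ¬ (p : ℤ) ∣ Dt.c → p ∣ NumberField.classNumber K →
    ∀ (D : (W.baseChange K).LambdaAdicSelmerData κ γ) (F : HeegnerFamily (W.conductorNorm ℤ) W K κ jbar)
      (X : (W.baseChange K).SelmerDualData κ γ), F.Dt = Dt →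
    Module.Finite (IwasawaAlgebra p) D.S → Module.Finite (IwasawaAlgebra p) X.X →
    Module.IsTorsion (IwasawaAlgebra p) (D.S ⧸ heegnerModule D F) →
    ∀ 𝔭 : PrimeSpectrum (IwasawaAlgebra p), 𝔭.asIdeal = Ideal.span {(p : IwasawaAlgebra p)} →
      Module.lengthAt (IwasawaAlgebra p) (Submodule.torsion (IwasawaAlgebra p) X.X) 𝔭 ≤
        2 * Module.lengthAt (IwasawaAlgebra p) (D.S ⧸ heegnerModule D F) 𝔭

/-! ### §1b The LADDER of (G) (rev 2, critic V#41 price P1): control G1a/G1b, fixed-layer Kolyvagin G2(j), residual G2-uniform -/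

/-- (G1a) **Anticyclotomic control, Selmer side** (print + bookkeeping; size M/L): in the frame of (G), for
all base layers `k₀ ≥ k₁` and all `j`, the layer quotient `X_tors/ν_{k₀,j}` is finite and
`#(X_tors/ν_{k₀,j} X_tors) ≤ p^{C(k₀+j+1)} · Q(k₀,j)`. Route: `0 → X_tors/ν → X/ν → X_tf/ν → 0`
(`Tor₁^Λ(X_tf, Λ/ν) = X_tf[ν] = 0`), `X/νX = (X/ω_k)/ν`, Greenberg–Mazur control
`X/ω_k X → Sel_{p^∞}(E/K_k)^∨` with finite kernel/cokernel of order `p^{O(1)}` along `K_∞/K` (`E(K_∞)[p] = 0`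
from `(irr_K)` in the pro-`p` tower; every `v ∣ N` splits in `K` hence is finitely decomposed in `K_∞`;
`v ∣ p` finitely decomposed; total ramification NOT used), and `(A^∨/ν)_{tors} = (A[ν]/div)^∨`.
Why it might fail: only through mis-typing (junk `0` of `nondivCard` if unbounded — it is bounded, `Sel`
being cofinitely generated). [cite: Greenberg1999, Thm. 1 / §4 (control)] [cite: MazurInvent1972, §6] -/
def Stmt.controlSelmerNu : Prop :=
  ∀ (W : WeierstrassCurve ℚ) [W.IsElliptic] [W.IsGloballyMinimal] (p : ℕ) [Fact p.Prime]
    [NeZero (W.conductorNorm ℤ)] (K : Type) [Field K] [NumberField K],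
    ClassX10 W p → ¬ Surj W 3 → ¬ W.HasCM →
    IsImaginaryQuadratic K → Odd (NumberField.discr K) → NumberField.discr K ≠ -3 →
    SatisfiesHeegnerHypothesis (W.conductorNorm ℤ) K → SatisfiesHeegnerHypothesis p K →
    (W.baseChange K).HasIrreducibleModPGaloisRep p →
    ∀ (κ : ZpExtension K p), κ.IsAnticyclotomic → ∀ (γ : Field.absoluteGaloisGroup K),
    κ.IsTopGenerator γ → ∀ (Dt : ModularParametrizationData W (W.conductorNorm ℤ)) (jbar : AlgebraicClosure K →+* ℂ),
    ¬ (p : ℤ) ∣ Dt.c → p ∣ NumberField.classNumber K →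
    ∀ (D : (W.baseChange K).LambdaAdicSelmerData κ γ) (F : HeegnerFamily (W.conductorNorm ℤ) W K κ jbar)
      (X : (W.baseChange K).SelmerDualData κ γ), F.Dt = Dt →
    Module.Finite (IwasawaAlgebra p) D.S → Module.Finite (IwasawaAlgebra p) X.X →
    Module.IsTorsion (IwasawaAlgebra p) (D.S ⧸ heegnerModule D F) →
    ∃ C k₁ : ℕ, ∀ k₀ : ℕ, k₁ ≤ k₀ → ∀ j : ℕ,
      Finite (Submodule.torsion (IwasawaAlgebra p) X.X ⧸
        (Ideal.span {layerNu p k₀ j} • ⊤ :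
          Submodule (IwasawaAlgebra p) (Submodule.torsion (IwasawaAlgebra p) X.X))) ∧
      layerCard p (Submodule.torsion (IwasawaAlgebra p) X.X) k₀ j ≤
        p ^ (C * (k₀ + j + 1)) * selmerLayerNuCard p (W.baseChange K) κ γ k₀ j

/-- (G1b) **Control, Heegner side** (print + bookkeeping; size M/L): in the frame of (G), for all `k₀ ≥ k₁`
and all `j`, `(𝔖/ℋ_F)/ν_{k₀,j}` is finite and `I(k₀,j) ≤ p^{C(k₀+j+1)} · #((𝔖/ℋ_F)/ν_{k₀,j})`. Route:
`D.proj k : 𝔖 → S_p(E/K_k)` maps `ℋ_F` into `ℋ̄_k` (definition of `heegnerModule`) and `ν𝔖` into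
`ν S_p(E/K_k)` (`proj_X`), so `𝔖/(ℋ_F + ν𝔖) → S_p(E/K_k)/(ℋ̄_k + ν S_p)` and
`I ≤ #(𝔖/(ℋ_F+ν𝔖)) · #coker`; the cokernel is `S_p(E/K_k)/(universal norms + ℋ̄_k + ν S_p)`: in
characters of level `≤ k₀`, `ν` acts as `p^j` on a group of `ℤ_p`-rank `≤ C(k₀)` (factor `p^{C(k₀) j}`);
in characters of level `k₀ < t ≤ k`, `S_p^χ` has rank one (Bertolini–Darmon 1990, `y_χ ≠ 0` by
Cornut–Vatsal for `k₀ ≫ 0`) and `ℋ̄_k^χ ∋ y_χ ≠ 0`, so the defect is the finite `p`-part bounded via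
compact control. Why it might fail: the per-character torsion defects must sum to `O(k)` in the exponent,
not `O(p^k)` — the same bookkeeping as desk check (b) (Lines/gorenstein-layer-deskcheck.md §1), which found
`p^{O(1)}` per new level. [cite: CornutInvent2002, Thm.] [cite: Howard2004HeegnerKolyvagin, §3.3]
Bertolini–Darmon, Crelle 412 (1990) Thm. A. -/
def Stmt.controlHeegnerNu : Prop :=
  ∀ (W : WeierstrassCurve ℚ) [W.IsElliptic] [W.IsGloballyMinimal] (p : ℕ) [Fact p.Prime]
    [NeZero (W.conductorNorm ℤ)] (K : Type) [Field K] [NumberField K],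
    ClassX10 W p → ¬ Surj W 3 → ¬ W.HasCM →
    IsImaginaryQuadratic K → Odd (NumberField.discr K) → NumberField.discr K ≠ -3 →
    SatisfiesHeegnerHypothesis (W.conductorNorm ℤ) K → SatisfiesHeegnerHypothesis p K →
    (W.baseChange K).HasIrreducibleModPGaloisRep p →
    ∀ (κ : ZpExtension K p), κ.IsAnticyclotomic → ∀ (γ : Field.absoluteGaloisGroup K),
    κ.IsTopGenerator γ → ∀ (Dt : ModularParametrizationData W (W.conductorNorm ℤ)) (jbar : AlgebraicClosure K →+* ℂ),
    ¬ (p : ℤ) ∣ Dt.c → p ∣ NumberField.classNumber K →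
    ∀ (D : (W.baseChange K).LambdaAdicSelmerData κ γ) (F : HeegnerFamily (W.conductorNorm ℤ) W K κ jbar)
      (X : (W.baseChange K).SelmerDualData κ γ), F.Dt = Dt →
    Module.Finite (IwasawaAlgebra p) D.S → Module.Finite (IwasawaAlgebra p) X.X →
    Module.IsTorsion (IwasawaAlgebra p) (D.S ⧸ heegnerModule D F) →
    ∃ C k₁ : ℕ, ∀ k₀ : ℕ, k₁ ≤ k₀ → ∀ j : ℕ,
      Finite ((D.S ⧸ heegnerModule D F) ⧸
        (Ideal.span {layerNu p k₀ j} • ⊤ : Submodule (IwasawaAlgebra p) (D.S ⧸ heegnerModule D F))) ∧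
      heegnerLayerNuIndex γ F k₀ j ≤
        p ^ (C * (k₀ + j + 1)) * layerCard p (D.S ⧸ heegnerModule D F) k₀ j

/-- (G2(j)) **The fixed-layer equivariant Kolyvagin inequality at relative height `j`** — typed PER `j`:
in the frame of (G) there are `C` (depending on `j` and the frame, NOT on `k₀`) and `k₁` with
`Q(k₀,j) ≤ p^C · I(k₀,j)²` for every `k₀ ≥ k₁`, i.e. over the NUMBER FIELD `K_{k₀+j}`:
`#(Sel_{p^∞}(E/K_k)[ν]/div) ≤ p^C · [S_p(E/K_k) : ℋ̄_k + ν S_p(E/K_k)]²`, coefficients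
`R = Λ/(ν_{k₀,j}, p^M) = ℤ/p^M[Gal(K_k/K)]/(ω_{k₀})^⊥`. THE LADDER: `j = 0` vacuous (`ν = 1`); `j = 1`:
`R = ℤ_p[ζ_{p^{k₀+1}}]/p^M`, a DVR quotient — Kolyvagin's descent at ONE character level = PRINT-ADJACENT
(Bertolini–Darmon 1990 Thm. A per `χ`; Howard 2004 §2 machine over the DVR `S_𝔓`, `𝔓 = (Φ_{p^{k₀+1}}(1+T))`
a height-one prime with `Λ/𝔓` maximal; MZ26 Thm 2.40 for the residually-2-group image; the classes come from
`y_k ∈ E(K_k)` directly, no `Λ`-adic interpolation, so `3 ∣ h_K` enters only via `K_k ⊂ K[p^{k+1+δ}]`);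
`j = 2`: `R = Λ/(Φ_{p^{k₀+1}}Φ_{p^{k₀+2}}, p^M)`, the first non-DVR GORENSTEIN ring — first research instance
(Howard's sign alternation `ε_{nℓ} = −ε_n` + Matlis duality over `R`; Sakamoto 2018 / Bullach–Burns 2025
Thm 68 are the MR-type transfer sources). Why it might fail (j ≥ 2): freeness of the rank-one part of
`Sel(K_k, E[p^M])` over `R` at characters where `y_χ` is residually trivial («trivial zeros mod p»).
[cite: MastellaZerman2026, Thm. 2.40] [cite: Howard2004HeegnerKolyvagin, §2.2, Thm. 2.2.10 proof] -/
def Stmt.layerKolyvaginAt (j : ℕ) : Prop :=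
  ∀ (W : WeierstrassCurve ℚ) [W.IsElliptic] [W.IsGloballyMinimal] (p : ℕ) [Fact p.Prime]
    [NeZero (W.conductorNorm ℤ)] (K : Type) [Field K] [NumberField K],
    ClassX10 W p → ¬ Surj W 3 → ¬ W.HasCM →
    IsImaginaryQuadratic K → Odd (NumberField.discr K) → NumberField.discr K ≠ -3 →
    SatisfiesHeegnerHypothesis (W.conductorNorm ℤ) K → SatisfiesHeegnerHypothesis p K →
    (W.baseChange K).HasIrreducibleModPGaloisRep p →
    ∀ (κ : ZpExtension K p), κ.IsAnticyclotomic → ∀ (γ : Field.absoluteGaloisGroup K),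
    κ.IsTopGenerator γ → ∀ (Dt : ModularParametrizationData W (W.conductorNorm ℤ)) (jbar : AlgebraicClosure K →+* ℂ),
    ¬ (p : ℤ) ∣ Dt.c → p ∣ NumberField.classNumber K →
    ∀ (D : (W.baseChange K).LambdaAdicSelmerData κ γ) (F : HeegnerFamily (W.conductorNorm ℤ) W K κ jbar)
      (X : (W.baseChange K).SelmerDualData κ γ), F.Dt = Dt →
    Module.Finite (IwasawaAlgebra p) D.S → Module.Finite (IwasawaAlgebra p) X.X →
    Module.IsTorsion (IwasawaAlgebra p) (D.S ⧸ heegnerModule D F) →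
    ∃ C k₁ : ℕ, ∀ k₀ : ℕ, k₁ ≤ k₀ →
      selmerLayerNuCard p (W.baseChange K) κ γ k₀ j ≤ p ^ C * heegnerLayerNuIndex γ F k₀ j ^ 2

/-- (G2-uniform) **the RESIDUAL**: the fixed-layer inequalities hold for all `j ≥ j₀` with ONE base `k₁` and
exponent LINEAR in `j`: `Q(k₀,j) ≤ p^{C(j+1)} · I(k₀,j)²` (`k₀ ≥ k₁`). This — not (G2(j)) for any single
`j` — is what (G) consumes; it is the research statement of the line in its sharpest honest form (error
`p^{O(j)}`, not `p^{O(p^j)}`: character-by-character descents give `[∏_χ 𝒪_χ : Λ/ν] = p^{≍ p^j}` and are NOT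
enough). Not in print. [cite: Howard2004HeegnerKolyvagin, Thm. 2.2.10 proof («up to O(1) as m varies»)]
[cite: MastellaZerman2026, Thm. 2.40] -/
def Stmt.layerKolyvaginUniform : Prop :=
  ∀ (W : WeierstrassCurve ℚ) [W.IsElliptic] [W.IsGloballyMinimal] (p : ℕ) [Fact p.Prime]
    [NeZero (W.conductorNorm ℤ)] (K : Type) [Field K] [NumberField K],
    ClassX10 W p → ¬ Surj W 3 → ¬ W.HasCM →
    IsImaginaryQuadratic K → Odd (NumberField.discr K) → NumberField.discr K ≠ -3 →
    SatisfiesHeegnerHypothesis (W.conductorNorm ℤ) K → SatisfiesHeegnerHypothesis p K →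
    (W.baseChange K).HasIrreducibleModPGaloisRep p →
    ∀ (κ : ZpExtension K p), κ.IsAnticyclotomic → ∀ (γ : Field.absoluteGaloisGroup K),
    κ.IsTopGenerator γ → ∀ (Dt : ModularParametrizationData W (W.conductorNorm ℤ)) (jbar : AlgebraicClosure K →+* ℂ),
    ¬ (p : ℤ) ∣ Dt.c → p ∣ NumberField.classNumber K →
    ∀ (D : (W.baseChange K).LambdaAdicSelmerData κ γ) (F : HeegnerFamily (W.conductorNorm ℤ) W K κ jbar)
      (X : (W.baseChange K).SelmerDualData κ γ), F.Dt = Dt →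
    Module.Finite (IwasawaAlgebra p) D.S → Module.Finite (IwasawaAlgebra p) X.X →
    Module.IsTorsion (IwasawaAlgebra p) (D.S ⧸ heegnerModule D F) →
    ∃ C k₁ j₀ : ℕ, ∀ k₀ : ℕ, k₁ ≤ k₀ → ∀ j : ℕ, j₀ ≤ j →
      selmerLayerNuCard p (W.baseChange K) κ γ k₀ j ≤
        p ^ (C * (j + 1)) * heegnerLayerNuIndex γ F k₀ j ^ 2

/-! ## §2 Stubs (the ONLY sorries) -/

/-- stub (A): μ from layer growth. [cite: Washington1997, §13.3 (Thm. 13.13, Lemmas 13.18–13.21)]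
[cite: Howard2004HeegnerKolyvagin, proof of Thm. 2.2.10] -/
theorem stub_lengthAt_le_two_mul_of_layerCard_le : Stmt.lengthAtOfLayerCard := by
  sorry

/-- stub (G1a): anticyclotomic control, Selmer side (print + bookkeeping).
[cite: Greenberg1999, §4 (control theorem)] [cite: MazurInvent1972, §6] -/
theorem stub_controlSelmerNu : Stmt.controlSelmerNu := by
  sorry

/-- stub (G1b): control, Heegner side (compact control + Cornut–Vatsal + Bertolini–Darmon; print + bookkeeping).
[cite: CornutInvent2002, Thm.] [cite: Howard2004HeegnerKolyvagin, §3.3] -/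
theorem stub_controlHeegnerNu : Stmt.controlHeegnerNu := by
  sorry

/-- stub (G2(1)) — the PRINT-ADJACENT RUNG of the ladder (DVR coefficients `ℤ_p[ζ_{p^{k₀+1}}]/p^M`:
Kolyvagin's descent at one character level). Deliberately NOT in the cone of (G) (which needs G2-uniform):
it is the witness that the fixed-layer statement is decided in a regime where the crux is not.
[cite: MastellaZerman2026, Thm. 2.40] [cite: Howard2004HeegnerKolyvagin, Thm. 2.2.10 proof]
Bertolini–Darmon, Crelle 412 (1990), Thm. A. -/
theorem stub_layerKolyvaginAt_one : Stmt.layerKolyvaginAt 1 := by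
  sorry

/-- stub (G2-uniform) — THE research residual (not in print): exponent linear in `j`.
[cite: Howard2004HeegnerKolyvagin, Thm. 1.6.1, Thm. 2.2.10] [cite: MastellaZerman2026, Lemma 2.39, Thm. 2.40]
Sakamoto ANT 12 (2018); Bullach–Burns arXiv:2509.13894 Thm 68. -/
theorem stub_layerKolyvaginUniform : Stmt.layerKolyvaginUniform := by
  sorry

/-! ## §2b The ladder composes to (G) (sorry-free) -/

/-- exponent bookkeeping for the three-step chain. [folklore] -/
theorem chain_bound (p C₁ C₂ C₃ k₀ j a q i b : ℕ) (hp : 1 ≤ p)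
    (h1 : a ≤ p ^ (C₁ * (k₀ + j + 1)) * q) (h2 : q ≤ p ^ (C₃ * (j + 1)) * i ^ 2)
    (h3 : i ≤ p ^ (C₂ * (k₀ + j + 1)) * b) :
    a ≤ p ^ (((C₁ + 2 * C₂) * (k₀ + 1) + C₃) * (j + 1)) * b ^ 2 := by
  have hi2 : i ^ 2 ≤ (p ^ (C₂ * (k₀ + j + 1)) * b) ^ 2 := Nat.pow_le_pow_left h3 2
  have hkj : k₀ + j + 1 ≤ (k₀ + 1) * (j + 1) := by nlinarith [Nat.zero_le (k₀ * j)]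
  have hexp : C₁ * (k₀ + j + 1) + C₃ * (j + 1) + 2 * (C₂ * (k₀ + j + 1)) ≤
      ((C₁ + 2 * C₂) * (k₀ + 1) + C₃) * (j + 1) := by
    have e1 : C₁ * (k₀ + j + 1) ≤ C₁ * ((k₀ + 1) * (j + 1)) := Nat.mul_le_mul_left _ hkj
    have e2 : C₂ * (k₀ + j + 1) ≤ C₂ * ((k₀ + 1) * (j + 1)) := Nat.mul_le_mul_left _ hkj
    nlinarith [e1, e2]
  calc a ≤ p ^ (C₁ * (k₀ + j + 1)) * q := h1
    _ ≤ p ^ (C₁ * (k₀ + j + 1)) * (p ^ (C₃ * (j + 1)) * i ^ 2) := Nat.mul_le_mul_left _ h2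
    _ ≤ p ^ (C₁ * (k₀ + j + 1)) * (p ^ (C₃ * (j + 1)) * (p ^ (C₂ * (k₀ + j + 1)) * b) ^ 2) :=
        Nat.mul_le_mul_left _ (Nat.mul_le_mul_left _ hi2)
    _ = p ^ (C₁ * (k₀ + j + 1) + C₃ * (j + 1) + 2 * (C₂ * (k₀ + j + 1))) * b ^ 2 := by ring
    _ ≤ p ^ (((C₁ + 2 * C₂) * (k₀ + 1) + C₃) * (j + 1)) * b ^ 2 :=
        Nat.mul_le_mul_right _ (Nat.pow_le_pow_right hp hexp)

/-- **(G1a) + (G1b) + (G2-uniform) ⇒ (G)** — the ladder composes (sorry-free). -/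
theorem layerKolyvaginGorenstein_of_ladder (h1a : Stmt.controlSelmerNu) (h1b : Stmt.controlHeegnerNu)
    (h2 : Stmt.layerKolyvaginUniform) : Stmt.layerKolyvaginGorenstein := by
  intro W _ _ p _ _ K _ _ hX hns hcm hK hodd h3 hHN hHp hirr κ hκ γ hγ Dt jbar hc hhK D F X hFDt hfinS hfinX
    htor
  obtain ⟨C₁, k₁, H1⟩ :=
    h1a W p K hX hns hcm hK hodd h3 hHN hHp hirr κ hκ γ hγ Dt jbar hc hhK D F X hFDt hfinS hfinX htor
  obtain ⟨C₂, k₂, H2⟩ :=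
    h1b W p K hX hns hcm hK hodd h3 hHN hHp hirr κ hκ γ hγ Dt jbar hc hhK D F X hFDt hfinS hfinX htor
  obtain ⟨C₃, k₃, j₀, H3⟩ :=
    h2 W p K hX hns hcm hK hodd h3 hHN hHp hirr κ hκ γ hγ Dt jbar hc hhK D F X hFDt hfinS hfinX htor
  refine ⟨(C₁ + 2 * C₂) * (max (max k₁ k₂) k₃ + 1) + C₃, max (max k₁ k₂) k₃, j₀, fun j hj ↦ ?_⟩
  have hk₁ : k₁ ≤ max (max k₁ k₂) k₃ := le_trans (le_max_left _ _) (le_max_left _ _)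
  have hk₂ : k₂ ≤ max (max k₁ k₂) k₃ := le_trans (le_max_right _ _) (le_max_left _ _)
  have hk₃ : k₃ ≤ max (max k₁ k₂) k₃ := le_max_right _ _
  obtain ⟨hfin₁, hle₁⟩ := H1 _ hk₁ j
  obtain ⟨hfin₂, hle₂⟩ := H2 _ hk₂ j
  have hle₃ := H3 _ hk₃ j hj
  exact ⟨hfin₁, hfin₂, chain_bound p C₁ C₂ C₃ _ j _ _ _ _ (Nat.Prime.one_lt (Fact.out)).le hle₁ hle₃ hle₂⟩

/-- (G) — now a THEOREM of the ladder stubs (sorries only through G1a, G1b, G2-uniform). -/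
theorem stub_layerKolyvagin_gorenstein : Stmt.layerKolyvaginGorenstein :=
  layerKolyvaginGorenstein_of_ladder stub_controlSelmerNu stub_controlHeegnerNu stub_layerKolyvaginUniform

/-! ## §3 Compositions (sorry-free) -/

/-- (G) + (A) ⇒ the μ-inequality. -/
theorem muInequality_of_layers (hA : Stmt.lengthAtOfLayerCard) (hG : Stmt.layerKolyvaginGorenstein) :
    Stmt.muInequality := by
  intro W _ _ p _ _ K _ _ hX hns hcm hK hodd h3 hHN hHp hirr κ hκ γ hγ Dt jbar hc hhK D F X hFDt hfinS hfinX
    htor 𝔭 h𝔭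
  haveI := hfinX
  haveI := hfinS
  haveI : IsNoetherian (IwasawaAlgebra p) X.X := isNoetherian_of_isNoetherianRing_of_finite _ _
  haveI : Module.Finite (IwasawaAlgebra p) (Submodule.torsion (IwasawaAlgebra p) X.X) := inferInstance
  haveI : Module.Finite (IwasawaAlgebra p) (D.S ⧸ heegnerModule D F) := inferInstance
  exact hA p (Submodule.torsion (IwasawaAlgebra p) X.X) (D.S ⧸ heegnerModule D F)
    (Submodule.torsion_isTorsion (R := IwasawaAlgebra p) (M := X.X)) htor
    (hG W p K hX hns hcm hK hodd h3 hHN hHp hirr κ hκ γ hγ Dt jbar hc hhK D F X hFDt hfinS hfinX htor) 𝔭 h𝔭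

/-- The μ-inequality ⇒ `MuPartSharpX10b` (the lead's promotion, rev 27, verbatim up to the target name).
[cite: Howard2004HeegnerKolyvagin, Thm. B (c)] -/
theorem muPartSharpX10b_of_muInequality (hμ : Stmt.muInequality) : MuPartSharpX10b := by
  intro W _ _ p _ _ K _ _ hX hns hcm hK hodd h3 hHN hHp hirr κ hκ γ hγ Dt H ιC jbar hc hrk hfin hhK
    ⟨D, F, X, m, hFDt, hfinX, hfinS, htor, hloc⟩
  haveI := hfinX
  haveI := hfinS
  haveI : IsNoetherian (IwasawaAlgebra p) X.X := isNoetherian_of_isNoetherianRing_of_finite _ _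
  haveI : Module.Finite (IwasawaAlgebra p) (Submodule.torsion (IwasawaAlgebra p) X.X) := inferInstance
  haveI : Module.Finite (IwasawaAlgebra p) (D.S ⧸ heegnerModule D F) := inferInstance
  refine ⟨D, F, X, hFDt, ?_⟩
  exact IwasawaAlgebra.sq_charIdeal_le_charIdeal_of_span_p_pow_mul_le_of_lengthAt_le_two_mul
    (Submodule.torsion_isTorsion (R := IwasawaAlgebra p) (M := X.X)) htor
    (hμ W p K hX hns hcm hK hodd h3 hHN hHp hirr κ hκ γ hγ Dt jbar hc hhK D F X hFDt hfinS hfinX htor) hloc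

/-- **The line**: (A) → (G) → `PrintX10b.MuPartSharpX10b` (stmt-BirchSwinnertonDyer-27487), BY NAME. -/
theorem MuPartSharpX10b_of (hA : Stmt.lengthAtOfLayerCard) (hG : Stmt.layerKolyvaginGorenstein) :
    Summit.BirchSwinnertonDyer.BirchSwinnertonDyer.Theses.PrintX10b.MuPartSharpX10b :=
  muPartSharpX10b_of_muInequality (muInequality_of_layers hA hG)

/-- Through the route's own glue item (27488) and the two print siblings (27485, 27486), taken BY NAME:
the parent deciding crux `HowardContainmentLightFrameX10bPinnedOfPrint` (27275). -/
theorem parent_of (hcop : CoprimeTiedX10b) (henv : EnvelopeModulesSharpX10b)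
    (hglue : HowardContainmentLightFrameX10bPinnedOfPrintOfSplit)
    (hA : Stmt.lengthAtOfLayerCard) (hG : Stmt.layerKolyvaginGorenstein) :
    Summit.BirchSwinnertonDyer.BirchSwinnertonDyer.Theses.PrintX10b.HowardContainmentLightFrameX10bPinnedOfPrint :=
  hglue hcop henv (MuPartSharpX10b_of hA hG)

/-- **The line, rev 2**: (A) → (G1a) → (G1b) → (G2-uniform) → `PrintX10b.MuPartSharpX10b` (27487), BY NAME. -/
theorem MuPartSharpX10b_of_ladder (hA : Stmt.lengthAtOfLayerCard) (h1a : Stmt.controlSelmerNu)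
    (h1b : Stmt.controlHeegnerNu) (h2 : Stmt.layerKolyvaginUniform) :
    Summit.BirchSwinnertonDyer.BirchSwinnertonDyer.Theses.PrintX10b.MuPartSharpX10b :=
  MuPartSharpX10b_of hA (layerKolyvaginGorenstein_of_ladder h1a h1b h2)

/-- rev 2: the parent deciding crux (27275) from the ladder, via 27485/27486/27488 BY NAME. -/
theorem parent_of_ladder (hcop : CoprimeTiedX10b) (henv : EnvelopeModulesSharpX10b)
    (hglue : HowardContainmentLightFrameX10bPinnedOfPrintOfSplit)
    (hA : Stmt.lengthAtOfLayerCard) (h1a : Stmt.controlSelmerNu)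
    (h1b : Stmt.controlHeegnerNu) (h2 : Stmt.layerKolyvaginUniform) :
    Summit.BirchSwinnertonDyer.BirchSwinnertonDyer.Theses.PrintX10b.HowardContainmentLightFrameX10bPinnedOfPrint :=
  hglue hcop henv (MuPartSharpX10b_of_ladder hA h1a h1b h2)

/-- the composed line (sorries only through the stubs A, G1a, G1b, G2-uniform). -/
theorem muPartSharpX10b_line : MuPartSharpX10b :=
  MuPartSharpX10b_of stub_lengthAt_le_two_mul_of_layerCard_le stub_layerKolyvagin_gorenstein

end Summit.BirchSwinnertonDyer.BirchSwinnertonDyer.Cruxes.HowardContainmentAnyClassNumberX10b.GorensteinLayerMuX10b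

end
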